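import Mathlib
import HarnessLib.Audit
import Summits.PneNP.PneNP.Theorems.PstarMenuLocality
import Summits.PneNP.PneNP.Theorems.PstarTipsChain

/-!
# Near truncation: on the slice, the second reader of a terminal pair equals its LOCAL part (ROUND-24, O1; memo g26 §62)

FRONTIER range-avoidance ladder, rung F-N3, ROUND 24 (cell `pnp-ideate`, prover-2 memo `g26/O1-LOCALITY-g26.md` §62; typed targets
`PstarCoreBoundTargets.TerminalFive` / `TerminalPeelable` (p646951); census node `PstarSharpGateBudgetAssembly.SharpMenuCriterionBoundGateBudget`;
restricted-model proof complexity — nothing here bears on `P` versus `NP`).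

`PstarMenuLocality` pins, for a terminal pair `(K; Γ₁, Γ₂)` and every variable `φ` FOREIGN to the `Γ₁`-side (in no output of `K`, not in `C₁`, in no
monomial of `Γ₁`), the partner sum `[φ ∈ C₂] + starSum G₂ φ ≡ 0` on the slice `A = Sol(K) ∩ {Γ₁ = b₁}`, and excludes monomials with two foreign
variables.  Summing `x_φ · (that)` over a set `Φ` of foreign variables gives the bookkeeping identity

  `Γ₂ = Γ₂^Φ ⊕ Σ_{φ ∈ Φ} x_φ·([φ ∈ C₂] ⊕ starSum G₂ φ)`,  `Γ₂^Φ := (C₂ ∖ Φ, {g ∈ G₂ : both AND variables ∉ Φ})` (`bit_gval_eq_trunc_add`),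

so on `A` the reader `Γ₂` COINCIDES WITH ITS NEAR TRUNCATION `Γ₂^Φ` (`gval_trunc_eq_on_slice`).  Consequences (all `k`):

* **`trunc_misses_on_slice`** — (T3) holds for `(K; Γ₁, Γ₂^Φ)`: the far decorations (releases, outside reads) of an exact certificate's menu are
  irrelevant to infeasibility;
* **`exists_near_core`** — if `Γ₁ ∧ Γ₂^Φ` is satisfiable at all, some `M ⊆ K` is a `TerminalNC` core for the LOCAL pair `(Γ₁, Γ₂^Φ)`; inside the
  core-bound induction its XOR core has at most five members (`card_xcore_near_le_five`, via `PstarTipsChain.core_terminal`).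

For the census (with `Φ` := all variables foreign to `(K₀, d₁)` of an exact certificate): every certifying menu `G` is a LOCAL menu `G^Φ` (monomials
over the near variables `T(K₀) ∪ ANDvars(F₁)`) that is itself infeasible with `d₁` on `K₀` — certifying on a sub-core after peeling, or an
empty-core coincidence — plus far decorations whose partner sums are pinned on the slice (`starSum_pinned`; conversely admissible when pinned,
`PstarMenuRelease`).  This is the rigorous form of "superset menus certify when local" (p3 memo §14.65 S2).
-/

set_option linter.dupNamespace false -- `Summit.PneNP.PneNP.…`: summit = sub-problem name (D-0017 single-conjunct layout)

open Finset Literature.Computability.Complexity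
open Summit.PneNP.PneNP.Theorems.PstarFibrePolys (bit bit_injective)
open Summit.PneNP.PneNP.Theorems.PstarTyped (Typed)
open Summit.PneNP.PneNP.Theorems.PstarSALevel (varSet bdry BoundaryExpanding SimpleOverlap)
open Summit.PneNP.PneNP.Theorems.PstarGapOneAll (gval)
open Summit.PneNP.PneNP.Theorems.PstarGConstraint (bit_gval)
open Summit.PneNP.PneNP.Theorems.PstarCoreBoundTargets (Terminal)
open Summit.PneNP.PneNP.Theorems.PstarMenuLocality (starSum starSum_pinned false_of_far_monomial pair_unique exists_sol_on_target₁)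
open Summit.PneNP.PneNP.Theorems.PstarUnion (SatPair)
open Summit.PneNP.PneNP.Theorems.PstarUnionCovers (TerminalNC exists_minimal_core)
open Summit.PneNP.PneNP.Theorems.PstarTipsPeel (xcore xcore_subset)
open Summit.PneNP.PneNP.Theorems.PstarTipsChain (core_terminal)

namespace Summit.PneNP.PneNP.Theorems.PstarNearTruncation

variable {n m : ℕ}

/-! ## The near truncation of a reader and the bookkeeping identity -/
section Trunc

variable (I : LocalMap 4 n m)

/-- The monomials of `G` with NO AND variable in `Φ` (the near monomials). -/
def nearMonomials (G : Finset (Fin m)) (Φ : Finset (Fin n)) : Finset (Fin m) :=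
  G.filter fun g => I.vars g 2 ∉ Φ ∧ I.vars g 3 ∉ Φ

/-- Near monomials are monomials. -/
theorem nearMonomials_subset (G : Finset (Fin m)) (Φ : Finset (Fin n)) : nearMonomials I G Φ ⊆ G := filter_subset _ _

/-- Membership in `nearMonomials`. -/
theorem mem_nearMonomials {G : Finset (Fin m)} {Φ : Finset (Fin n)} {g : Fin m} :
    g ∈ nearMonomials I G Φ ↔ g ∈ G ∧ I.vars g 2 ∉ Φ ∧ I.vars g 3 ∉ Φ := by
  unfold nearMonomials; rw [mem_filter]

/-- The FAR TERM of the reader `(C, G)` at `z` relative to `Φ`: `Σ_{φ ∈ Φ} x_φ·([φ ∈ C] + starSum G φ)`. -/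
def farTerm (C : Finset (Fin n)) (G : Finset (Fin m)) (Φ : Finset (Fin n)) (z : Fin n → Bool) : ZMod 2 :=
  ∑ φ ∈ Φ, bit (z φ) * ((if φ ∈ C then 1 else 0) + starSum I G φ z)

/-- The linear part splits along `Φ`. -/
private theorem sum_lin_split (C Φ : Finset (Fin n)) (z : Fin n → Bool) :
    ∑ v ∈ C, bit (z v) = ∑ v ∈ C \ Φ, bit (z v) + ∑ φ ∈ Φ, bit (z φ) * (if φ ∈ C then (1 : ZMod 2) else 0) := by
  classical
  rw [← sum_filter_add_sum_filter_not C (fun v => v ∈ Φ)]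
  have e1 : C.filter (fun v => v ∉ Φ) = C \ Φ := by ext v; rw [mem_filter, mem_sdiff]
  have e2 : ∑ φ ∈ Φ, bit (z φ) * (if φ ∈ C then (1 : ZMod 2) else 0) = ∑ v ∈ C.filter (fun v => v ∈ Φ), bit (z v) := by
    rw [sum_filter]
    have : ∀ φ ∈ Φ, bit (z φ) * (if φ ∈ C then (1 : ZMod 2) else 0) = if φ ∈ C then bit (z φ) else 0 := fun φ _ => by
      split_ifs <;> simp
    rw [sum_congr rfl this, ← sum_filter, ← sum_filter]
    exact sum_congr (by ext v; rw [mem_filter, mem_filter, and_comm]) fun _ _ => rfl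
  rw [e1, e2, add_comm]

/-- The monomial part: `Σ_{φ ∈ Φ} x_φ · starSum G φ = Σ_{g ∈ G} ([p_g ∈ Φ] + [q_g ∈ Φ])·x_{p_g} x_{q_g}`. -/
private theorem sum_mono_split (G : Finset (Fin m)) (Φ : Finset (Fin n)) (z : Fin n → Bool) :
    ∑ φ ∈ Φ, bit (z φ) * starSum I G φ z =
      ∑ g ∈ G, ((if I.vars g 2 ∈ Φ then (1 : ZMod 2) else 0) + (if I.vars g 3 ∈ Φ then 1 else 0)) *
        (bit (z (I.vars g 2)) * bit (z (I.vars g 3))) := by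
  classical
  unfold starSum
  simp_rw [mul_sum]
  rw [sum_comm]
  refine sum_congr rfl fun g _ => ?_
  have h2 : ∑ φ ∈ Φ, bit (z φ) * (if I.vars g 2 = φ then bit (z (I.vars g 3)) else 0) =
      (if I.vars g 2 ∈ Φ then (1 : ZMod 2) else 0) * (bit (z (I.vars g 2)) * bit (z (I.vars g 3))) := by
    have : ∀ φ ∈ Φ, bit (z φ) * (if I.vars g 2 = φ then bit (z (I.vars g 3)) else 0) =
        if I.vars g 2 = φ then bit (z (I.vars g 2)) * bit (z (I.vars g 3)) else 0 := fun φ _ => by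
      split_ifs with h
      · rw [h]
      · rw [mul_zero]
    rw [sum_congr rfl this, sum_ite_eq]
    split_ifs <;> simp
  have h3 : ∑ φ ∈ Φ, bit (z φ) * (if I.vars g 3 = φ then bit (z (I.vars g 2)) else 0) =
      (if I.vars g 3 ∈ Φ then (1 : ZMod 2) else 0) * (bit (z (I.vars g 2)) * bit (z (I.vars g 3))) := by
    have : ∀ φ ∈ Φ, bit (z φ) * (if I.vars g 3 = φ then bit (z (I.vars g 2)) else 0) =
        if I.vars g 3 = φ then bit (z (I.vars g 2)) * bit (z (I.vars g 3)) else 0 := fun φ _ => by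
      split_ifs with h
      · rw [h, mul_comm]
      · rw [mul_zero]
    rw [sum_congr rfl this, sum_ite_eq]
    split_ifs <;> simp
  rw [show (∑ φ ∈ Φ, bit (z φ) * ((if I.vars g 2 = φ then bit (z (I.vars g 3)) else 0) +
      (if I.vars g 3 = φ then bit (z (I.vars g 2)) else 0))) =
      ∑ φ ∈ Φ, (bit (z φ) * (if I.vars g 2 = φ then bit (z (I.vars g 3)) else 0) +
        bit (z φ) * (if I.vars g 3 = φ then bit (z (I.vars g 2)) else 0)) from sum_congr rfl fun _ _ => mul_add _ _ _,
    sum_add_distrib, h2, h3]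
  ring

/-- **THE BOOKKEEPING IDENTITY.**  If no monomial of `G` has both AND variables in `Φ`, then
`gval C G = gval (C ∖ Φ) (nearMonomials G Φ) + farTerm C G Φ` (in `𝔽₂`, pointwise). -/
theorem bit_gval_eq_trunc_add (C : Finset (Fin n)) {G : Finset (Fin m)} {Φ : Finset (Fin n)}
    (hFF : ∀ g ∈ G, ¬ (I.vars g 2 ∈ Φ ∧ I.vars g 3 ∈ Φ)) (z : Fin n → Bool) :
    bit (gval I C G z) = bit (gval I (C \ Φ) (nearMonomials I G Φ) z) + farTerm I C G Φ z := by
  classical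
  unfold farTerm
  simp_rw [mul_add]
  rw [sum_add_distrib, sum_mono_split, bit_gval, bit_gval, sum_lin_split C Φ z]
  -- the monomials: near ones once, touching ones once
  have hsplit := sum_filter_add_sum_filter_not G (fun g => I.vars g 2 ∉ Φ ∧ I.vars g 3 ∉ Φ)
    (f := fun g => bit (z (I.vars g 2)) * bit (z (I.vars g 3)))
  have htouch : ∑ g ∈ G, ((if I.vars g 2 ∈ Φ then (1 : ZMod 2) else 0) + (if I.vars g 3 ∈ Φ then 1 else 0)) *
      (bit (z (I.vars g 2)) * bit (z (I.vars g 3))) =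
      ∑ g ∈ G.filter (fun g => ¬ (I.vars g 2 ∉ Φ ∧ I.vars g 3 ∉ Φ)), bit (z (I.vars g 2)) * bit (z (I.vars g 3)) := by
    rw [sum_filter]
    refine sum_congr rfl fun g hg => ?_
    have hg' := hFF g hg
    by_cases h2 : I.vars g 2 ∈ Φ
    · have h3 : I.vars g 3 ∉ Φ := fun h => hg' ⟨h2, h⟩
      simp [h2, h3]
    · by_cases h3 : I.vars g 3 ∈ Φ
      · simp [h2, h3]
      · simp [h2, h3]
  rw [htouch, ← hsplit]
  unfold nearMonomials
  ring

end Trunc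

/-! ## On the slice the reader equals its near truncation -/
section Slice

variable {I : LocalMap 4 n m} {r : ℕ} {y : Fin m → Bool} {K : Finset (Fin m)} {w₁ w₂ : Finset (Fin n) × Finset (Fin m) × Bool}
  {Φ : Finset (Fin n)}

/-- No monomial of `Γ₂` has two foreign variables (from `false_of_far_monomial`). -/
theorem no_far_far (hI : I.IsPure xorAndPred) (hT : Typed I) (hS : SimpleOverlap I) (hB : BoundaryExpanding r I)
    (ht : Terminal I r y K w₁ w₂) (hΦK : ∀ φ ∈ Φ, ∀ j ∈ K, φ ∉ varSet I j) (hΦC : ∀ φ ∈ Φ, φ ∉ w₁.1)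
    (hΦG : ∀ φ ∈ Φ, ∀ g ∈ w₁.2.1, I.vars g 2 ≠ φ ∧ I.vars g 3 ≠ φ) :
    ∀ g ∈ w₂.2.1, ¬ (I.vars g 2 ∈ Φ ∧ I.vars g 3 ∈ Φ) := by
  intro g hg ⟨h2, h3⟩
  exact false_of_far_monomial hI ht hg (Or.inl ⟨rfl, rfl⟩) (pair_unique hI hS g) (hΦK _ h2) (hΦC _ h2) (hΦG _ h2)
    (hΦK _ h3) (hΦC _ h3) (hΦG _ h3) (exists_sol_on_target₁ hI hT hS hB ht)

/-- **ON THE SLICE, `Γ₂` EQUALS ITS NEAR TRUNCATION** (every far partner sum is pinned to zero there). -/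
theorem gval_trunc_eq_on_slice (hI : I.IsPure xorAndPred) (hT : Typed I) (hS : SimpleOverlap I) (hB : BoundaryExpanding r I)
    (ht : Terminal I r y K w₁ w₂) (hΦK : ∀ φ ∈ Φ, ∀ j ∈ K, φ ∉ varSet I j) (hΦC : ∀ φ ∈ Φ, φ ∉ w₁.1)
    (hΦG : ∀ φ ∈ Φ, ∀ g ∈ w₁.2.1, I.vars g 2 ≠ φ ∧ I.vars g 3 ≠ φ)
    {x : Fin n → Bool} (hx : ∀ j ∈ K, I.eval x j = y j) (hx₁ : gval I w₁.1 w₁.2.1 x = w₁.2.2) :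
    gval I (w₂.1 \ Φ) (nearMonomials I w₂.2.1 Φ) x = gval I w₂.1 w₂.2.1 x := by
  apply bit_injective
  have h := bit_gval_eq_trunc_add I w₂.1 (no_far_far hI hT hS hB ht hΦK hΦC hΦG) x
  have hfar : farTerm I w₂.1 w₂.2.1 Φ x = 0 := by
    unfold farTerm
    exact sum_eq_zero fun φ hφ => by rw [starSum_pinned hI ht (hΦK φ hφ) (hΦC φ hφ) (hΦG φ hφ) hx hx₁, mul_zero]
  rw [h, hfar, add_zero]

/-- **(T3) FOR THE TRUNCATED PAIR**: on `Sol(K) ∩ {Γ₁ = b₁}` the near truncation of `Γ₂` misses `b₂`. -/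
theorem trunc_misses_on_slice (hI : I.IsPure xorAndPred) (hT : Typed I) (hS : SimpleOverlap I) (hB : BoundaryExpanding r I)
    (ht : Terminal I r y K w₁ w₂) (hΦK : ∀ φ ∈ Φ, ∀ j ∈ K, φ ∉ varSet I j) (hΦC : ∀ φ ∈ Φ, φ ∉ w₁.1)
    (hΦG : ∀ φ ∈ Φ, ∀ g ∈ w₁.2.1, I.vars g 2 ≠ φ ∧ I.vars g 3 ≠ φ)
    {x : Fin n → Bool} (hx : ∀ j ∈ K, I.eval x j = y j) (hx₁ : gval I w₁.1 w₁.2.1 x = w₁.2.2) :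
    gval I (w₂.1 \ Φ) (nearMonomials I w₂.2.1 Φ) x ≠ w₂.2.2 := by
  rw [gval_trunc_eq_on_slice hI hT hS hB ht hΦK hΦC hΦG hx hx₁]
  exact fun h => ht.2.2.2.2.2.2.1 ⟨x, hx, hx₁, h⟩

/-! ## The local core -/

/-- **THE NEAR TRUNCATION PLANTS A LOCAL CORE.**  If the truncated pair `Γ₁ ∧ Γ₂^Φ` is satisfiable at all, some `M ⊆ K` is a `TerminalNC` core
for `(Γ₁, Γ₂^Φ)` — a certificate-type object whose second reader has NO variable in `Φ`. -/
theorem exists_near_core (hI : I.IsPure xorAndPred) (hT : Typed I) (hS : SimpleOverlap I) (hB : BoundaryExpanding r I)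
    (ht : Terminal I r y K w₁ w₂) (hΦK : ∀ φ ∈ Φ, ∀ j ∈ K, φ ∉ varSet I j) (hΦC : ∀ φ ∈ Φ, φ ∉ w₁.1)
    (hΦG : ∀ φ ∈ Φ, ∀ g ∈ w₁.2.1, I.vars g 2 ≠ φ ∧ I.vars g 3 ≠ φ)
    (hfeas : ∃ z : Fin n → Bool, gval I w₁.1 w₁.2.1 z = w₁.2.2 ∧ gval I (w₂.1 \ Φ) (nearMonomials I w₂.2.1 Φ) z = w₂.2.2) :
    ∃ M ⊆ K, TerminalNC I r y M w₁ (w₂.1 \ Φ, nearMonomials I w₂.2.1 Φ, w₂.2.2) := by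
  classical
  obtain ⟨hKr, hd₁, hd₂, hr⟩ : K.card < r ∧ Disjoint K w₁.2.1 ∧ Disjoint K w₂.2.1 ∧ (K ∪ w₁.2.1 ∪ w₂.2.1).card ≤ r :=
    ⟨ht.2.2.1, ht.2.2.2.1, ht.2.2.2.2.1, ht.2.2.2.2.2.1⟩
  have hns : ¬ SatPair I y K w₁ (w₂.1 \ Φ, nearMonomials I w₂.2.1 Φ, w₂.2.2) := by
    rintro ⟨x, hx, hx₁, hx₂⟩
    exact trunc_misses_on_slice hI hT hS hB ht hΦK hΦC hΦG hx hx₁ hx₂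
  obtain ⟨M, hMK, hM, hmin⟩ := exists_minimal_core I y hns
  refine ⟨M, hMK, ?_, lt_of_le_of_lt (card_le_card hMK) hKr, hd₁.mono_left hMK, ?_, ?_, hM, hmin⟩
  · rw [nonempty_iff_ne_empty]
    rintro rfl
    obtain ⟨z, hz₁, hz₂⟩ := hfeas
    exact hM ⟨z, fun j hj => absurd hj (notMem_empty j), hz₁, hz₂⟩
  · exact (hd₂.mono_left hMK).mono_right (nearMonomials_subset I _ _)
  · refine le_trans (card_le_card ?_) hr
    exact union_subset_union (union_subset_union hMK (Subset.refl _)) (nearMonomials_subset I _ _)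

/-- **Inside the core-bound induction the local core is small**: its XOR core has at most five members. -/
theorem card_xcore_near_le_five (hI : I.IsPure xorAndPred) (hT : Typed I) {M : Finset (Fin m)} (hMK : M ⊆ K)
    {w₂' : Finset (Fin n) × Finset (Fin m) × Bool} (hM : TerminalNC I r y M w₁ w₂')
    (hIH : ∀ K₀ ⊆ K, ∀ d₁ d₂ : Finset (Fin n) × Finset (Fin m) × Bool, Terminal I r y K₀ d₁ d₂ → K₀.card ≤ 5) :
    (xcore I M).card ≤ 5 := by
  classical
  rcases core_terminal I hI hT y M (w₁.2.1 ∪ w₂'.2.1) M.card M w₁ w₂' le_rfl (Subset.refl M) hM subset_union_left with h0 | ⟨A', w', ht', -⟩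
  · rw [h0, card_empty]; omega
  · exact hIH _ ((xcore_subset I M).trans hMK) A' w' ht'

end Slice

end Summit.PneNP.PneNP.Theorems.PstarNearTruncation
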